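import Mathlib
import HarnessLib
import Summits.Ventures.LatticeQCDFlow.Exactness.NCMCGeneralSpaceRestartChainCLT
import Summits.Ventures.LatticeQCDFlow.Scoring.CramerWoldDevice
import Summits.Ventures.LatticeQCDFlow.Scoring.MultivariateCLT

/-!
# The VECTOR CLT along the restart chain: a bounded observable with values in a finite-dimensional inner product space, from EVERY initial record law, converges to any Gaussian vector with the Green–Kubo projections

HONEST FRAMING: exact (Metropolis-corrected) sampling algorithms for lattice gauge theory;
figures of merit are autocorrelation/cost numbers at stated couplings and volumes; no
continuum-physics claim.

Venture `LatticeQCDFlow` (cell pub-lqcd), topic `Exactness`; FANOUT row 13 (`eng-snf`, GEN-25).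
NEW WORK of the cell assembling GEN-22's scalar CLT along the restart chain
(`CrooksPair.tendstoInDistribution_timeAverage_restartChain`, any bounded record observable, any
initial record law) with row 4's Cramér–Wold device (`Scoring/CramerWoldDevice`) and its
`IsGaussian` reading (`Scoring/MultivariateCLT.hasLaw_inner_of_isGaussian`); not a published
result; no definition; nothing cited as a fact (Cramér–Wold 1936 NAMED ONLY).

WHY (row 13).  Every derived number of the engine is a smooth function of a VECTOR of record
averages taken along the same stream (`reweighted_mean`: `(mean e^{−W} f(e), mean e^{−W})`;
`free_energy` with its `ess` and `mean_W`: `(mean e^{−W}, mean e^{−2W}, mean W)`; several sector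
weights at once).  GEN-25's `…ReplicaJackknifeFDeriv` takes the joint limit of such vectors as its
hypothesis, and `…ReplicaIndepVectorLimit` lifts per-stream vector limits to `R` independent
streams.  The per-stream VECTOR limit along correlated launches was not typed: GEN-22 gives, for
each bounded REAL observable `g`, `(√n)⁻¹ Σ_{i<n} (g(ω_i) − E_F g) ⇒ N(0, σ²_g)` with the
Green–Kubo variance `σ²_g` of the restart chain.  By Cramér–Wold this is already the vector
statement: for a bounded measurable `G` with values in a finite-dimensional real inner product
space `V`, `(√n)⁻¹ Σ_{i<n} (G(ω_i) − E_F G) ⇒ Z` for EVERY random vector `Z` whose projections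
`⟪t, Z⟫` have the laws `N(0, σ²_{⟪t,G⟫})` — in particular for `Z` distributed according to any
centred Gaussian measure on `V` with `Var[⟪t,·⟫] = σ²_{⟪t,G⟫}` for all `t`.

* **`CrooksPair.tendstoInDistribution_vectorTimeAverage_restartChain`** — the vector CLT from every
  initial record law, target given through its projections;
* **`CrooksPair.tendstoInDistribution_vectorTimeAverage_restartChain_of_isGaussian`** — the same
  with the target a Gaussian MEASURE `ν` on `V` (Mathlib `IsGaussian`), `HasLaw Z ν`;
  **`…_multivariateGaussian`** — target `multivariateGaussian 0 S` on `EuclideanSpace ℝ ι'` for a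
  positive semidefinite `S` with `tᵀ S t = σ²_{⟪t,G⟫}`.

NOT CLAIMED: the EXISTENCE / construction of the Gaussian target with the Green–Kubo covariance
(i.e. that `t ↦ σ²_{⟪t,G⟫}` is a quadratic form realised by a covariance operator) — the theorem is
stated for every admissible target; unbounded observables; rates.
-/

namespace Summit.Ventures.LatticeQCDFlow.Exactness.GeneralNCMC

open MeasureTheory ProbabilityTheory Set Filter Finset Matrix
open scoped ENNReal NNReal Topology RealInnerProductSpace

variable {Ω E : Type*} [MeasurableSpace Ω] [MeasurableSpace E]

namespace CrooksPair

variable {ν₀ ν₁ : Measure Ω} [IsFiniteMeasure ν₀] [IsFiniteMeasure ν₁] {κF κR : Kernel Ω E}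
  [IsMarkovKernel κF] [IsMarkovKernel κR] {s e : E → Ω} {W : E → ℝ}
  {V : Type*} [NormedAddCommGroup V] [InnerProductSpace ℝ V] [FiniteDimensional ℝ V]
  [MeasurableSpace V] [BorelSpace V]

omit [IsFiniteMeasure ν₁] [IsMarkovKernel κR] in
/-- **THE VECTOR CLT ALONG THE RESTART CHAIN, ANY INITIAL RECORD LAW.**  Crooks pair with
`Z₀ ≠ 0`; `K` Markov, `ν₀`-invariant, `m ≤ K(z, ·)` for all `z` (`m` finite, non-zero); `G : E → V`
measurable with `‖G‖ ≤ C`, `V` a finite-dimensional real inner product space; `μ₀` ANY initial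
record law.  For every random vector `Z` (on any probability space) whose projections `⟪t, Z⟫`
have the laws `N(0, σ²_t)`, `σ²_t` the Green–Kubo variance of the real observable `⟪t, G⟫` along
the restart chain `R = (κF ∘ₖ K).comap s`:
`(√n)⁻¹ Σ_{i<n} (G(ω_i) − E_F G) ⇒ Z` under the chain law from `μ₀`. -/
theorem tendstoInDistribution_vectorTimeAverage_restartChain (K : Kernel Ω Ω) [IsMarkovKernel K]
    (h0 : ν₀ univ ≠ 0) (hK : Kernel.Invariant K ν₀) (h : CrooksPair ν₀ ν₁ κF κR s e W)
    {m : Measure Ω} [IsFiniteMeasure m] (hm0 : m univ ≠ 0) (hmin : ∀ z, m ≤ K z)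
    {G : E → V} (hG : Measurable G) {C : ℝ} (hC : ∀ ω, ‖G ω‖ ≤ C)
    (μ₀ : Measure E) [IsProbabilityMeasure μ₀]
    {Ω' : Type*} [MeasurableSpace Ω'] {P' : Measure Ω'} [IsProbabilityMeasure P'] {Z : Ω' → V}
    (hZm : AEMeasurable Z P')
    (hZ : ∀ t : V, HasLaw (fun ω' => ⟪t, Z ω'⟫) (gaussianReal 0 (Real.toNNReal
      ((∫ ω, (⟪t, G ω⟫ - ∫ z, ⟪t, G z⟫ ∂(fwdPathLaw ν₀ κF)) ^ 2 ∂(fwdPathLaw ν₀ κF))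
      + 2 * ∑' k, ∫ ω, (⟪t, G ω⟫ - ∫ z, ⟪t, G z⟫ ∂(fwdPathLaw ν₀ κF))
        * (Scoring.kop ((κF ∘ₖ K).comap s h.measurable_s))^[k + 1]
            (fun ω => ⟪t, G ω⟫ - ∫ z, ⟪t, G z⟫ ∂(fwdPathLaw ν₀ κF)) ω ∂(fwdPathLaw ν₀ κF)))) P')
    [IsProbabilityMeasure (Kernel.trajMeasure (X := fun _ : ℕ => E) μ₀
        (fun n : ℕ => ((κF ∘ₖ K).comap s h.measurable_s).comap
          (fun hh : (j : ↥(Finset.Iic n)) → E => hh ⟨n, Finset.mem_Iic.2 le_rfl⟩)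
          (measurable_pi_apply _)))] :
    TendstoInDistribution (fun (n : ℕ) (ω : ℕ → E) =>
        (Real.sqrt n)⁻¹ • ∑ i ∈ Finset.range n, (G (ω i) - ∫ z, G z ∂(fwdPathLaw ν₀ κF)))
      atTop Z (fun _ => Kernel.trajMeasure (X := fun _ : ℕ => E) μ₀
        (fun n : ℕ => ((κF ∘ₖ K).comap s h.measurable_s).comap
          (fun hh : (j : ↥(Finset.Iic n)) → E => hh ⟨n, Finset.mem_Iic.2 le_rfl⟩)
          (measurable_pi_apply _))) P' := by
  haveI := isProbabilityMeasure_fwdPathLaw ν₀ h0 κF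
  have hGi : Integrable G (fwdPathLaw ν₀ κF) :=
    Integrable.of_bound hG.aestronglyMeasurable C (Eventually.of_forall hC)
  -- measurability of the vector statistic
  have hXm : ∀ n : ℕ, Measurable fun ω : ℕ → E =>
      (Real.sqrt n)⁻¹ • ∑ i ∈ Finset.range n, (G (ω i) - ∫ z, G z ∂(fwdPathLaw ν₀ κF)) :=
    fun n => (Finset.measurable_sum _ fun i _ =>
      (hG.comp (measurable_pi_apply i)).sub_const _).const_smul _
  refine Scoring.CardConsistency.tendstoInDistribution_of_forall_inner
    (fun n => (hXm n).aemeasurable) hZm fun t => ?_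
  -- the projection `⟪t, ·⟫` of the statistic is the scalar statistic of the observable `⟪t, G⟫`
  have hgt : Measurable fun ε => ⟪t, G ε⟫ :=
    (continuous_const.inner continuous_id).measurable.comp hG
  have hCt : ∀ ω, |⟪t, G ω⟫| ≤ ‖t‖ * C := fun ω =>
    (abs_real_inner_le_norm t (G ω)).trans (mul_le_mul_of_nonneg_left (hC ω) (norm_nonneg _))
  have hmean : ∫ z, ⟪t, G z⟫ ∂(fwdPathLaw ν₀ κF) = ⟪t, ∫ z, G z ∂(fwdPathLaw ν₀ κF)⟫ :=
    integral_inner hGi t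
  have hclt := h.tendstoInDistribution_timeAverage_restartChain K h0 hK hm0 hmin hgt hCt μ₀
    (P' := P') (Y := fun ω' => ⟪t, Z ω'⟫) (hZ t)
  refine hclt.congr (fun n => Eventually.of_forall fun ω => ?_) Filter.EventuallyEq.rfl
  show _ = ⟪t, (Real.sqrt (n : ℝ))⁻¹ • ∑ i ∈ Finset.range n,
    (G (ω i) - ∫ z, G z ∂(fwdPathLaw ν₀ κF))⟫
  rw [inner_smul_right, inner_sum]
  congr 1
  exact Finset.sum_congr rfl fun i _ => by rw [inner_sub_right, hmean]

omit [IsFiniteMeasure ν₁] [IsMarkovKernel κR] in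
/-- **The same with a Gaussian MEASURE as target**: if `ν` is a Gaussian measure on `V` (Mathlib
`IsGaussian`) whose projections are centred with the Green–Kubo variances,
`ν[⟪t,·⟫] = 0` and `Var[⟪t,·⟫; ν] = σ²_{⟪t,G⟫}` for every `t`, and `Z ∼ ν`, then
`(√n)⁻¹ Σ_{i<n} (G(ω_i) − E_F G) ⇒ Z` from every initial record law. -/
theorem tendstoInDistribution_vectorTimeAverage_restartChain_of_isGaussian (K : Kernel Ω Ω)
    [IsMarkovKernel K] (h0 : ν₀ univ ≠ 0) (hK : Kernel.Invariant K ν₀)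
    (h : CrooksPair ν₀ ν₁ κF κR s e W) {m : Measure Ω} [IsFiniteMeasure m] (hm0 : m univ ≠ 0)
    (hmin : ∀ z, m ≤ K z) {G : E → V} (hG : Measurable G) {C : ℝ} (hC : ∀ ω, ‖G ω‖ ≤ C)
    (μ₀ : Measure E) [IsProbabilityMeasure μ₀]
    {Ω' : Type*} [MeasurableSpace Ω'] {P' : Measure Ω'} [IsProbabilityMeasure P'] {Z : Ω' → V}
    {ν : Measure V} [IsGaussian ν] (hZν : HasLaw Z ν P')
    (hν0 : ∀ t : V, ∫ x, ⟪t, x⟫ ∂ν = 0)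
    (hνvar : ∀ t : V, Var[fun x => ⟪t, x⟫; ν]
      = (∫ ω, (⟪t, G ω⟫ - ∫ z, ⟪t, G z⟫ ∂(fwdPathLaw ν₀ κF)) ^ 2 ∂(fwdPathLaw ν₀ κF))
        + 2 * ∑' k, ∫ ω, (⟪t, G ω⟫ - ∫ z, ⟪t, G z⟫ ∂(fwdPathLaw ν₀ κF))
          * (Scoring.kop ((κF ∘ₖ K).comap s h.measurable_s))^[k + 1]
              (fun ω => ⟪t, G ω⟫ - ∫ z, ⟪t, G z⟫ ∂(fwdPathLaw ν₀ κF)) ω ∂(fwdPathLaw ν₀ κF))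
    [IsProbabilityMeasure (Kernel.trajMeasure (X := fun _ : ℕ => E) μ₀
        (fun n : ℕ => ((κF ∘ₖ K).comap s h.measurable_s).comap
          (fun hh : (j : ↥(Finset.Iic n)) → E => hh ⟨n, Finset.mem_Iic.2 le_rfl⟩)
          (measurable_pi_apply _)))] :
    TendstoInDistribution (fun (n : ℕ) (ω : ℕ → E) =>
        (Real.sqrt n)⁻¹ • ∑ i ∈ Finset.range n, (G (ω i) - ∫ z, G z ∂(fwdPathLaw ν₀ κF)))
      atTop Z (fun _ => Kernel.trajMeasure (X := fun _ : ℕ => E) μ₀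
        (fun n : ℕ => ((κF ∘ₖ K).comap s h.measurable_s).comap
          (fun hh : (j : ↥(Finset.Iic n)) → E => hh ⟨n, Finset.mem_Iic.2 le_rfl⟩)
          (measurable_pi_apply _))) P' := by
  refine h.tendstoInDistribution_vectorTimeAverage_restartChain K h0 hK hm0 hmin hG hC μ₀
    hZν.aemeasurable fun t => ?_
  have hlaw := Scoring.CardConsistency.hasLaw_inner_of_isGaussian hZν t
  have h0 : (∫ x, (fun x : V => ⟪t, x⟫) x ∂ν) = 0 := hν0 t
  rw [h0, hνvar t] at hlaw
  exact hlaw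

omit [IsFiniteMeasure ν₁] [IsMarkovKernel κR] in
/-- **The same with the MULTIVARIATE GAUSSIAN target of Mathlib**: for an observable with values
in `EuclideanSpace ℝ ι'` and a positive semidefinite matrix `S` whose quadratic form is the
Green–Kubo variance of the projections, `t ⬝ᵥ S *ᵥ t = σ²_{⟪t,G⟫}` for every `t`, the statistic
converges to the canonical variable on `(EuclideanSpace ℝ ι', multivariateGaussian 0 S)`.  (That
`t ↦ σ²_{⟪t,G⟫}` IS such a quadratic form is not proved here.) -/
theorem tendstoInDistribution_vectorTimeAverage_restartChain_multivariateGaussian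
    {ι' : Type*} [Fintype ι'] [DecidableEq ι'] (K : Kernel Ω Ω)
    [IsMarkovKernel K] (h0 : ν₀ univ ≠ 0) (hK : Kernel.Invariant K ν₀)
    (h : CrooksPair ν₀ ν₁ κF κR s e W) {m : Measure Ω} [IsFiniteMeasure m] (hm0 : m univ ≠ 0)
    (hmin : ∀ z, m ≤ K z) {G : E → EuclideanSpace ℝ ι'} (hG : Measurable G) {C : ℝ}
    (hC : ∀ ω, ‖G ω‖ ≤ C) (μ₀ : Measure E) [IsProbabilityMeasure μ₀]
    {S : Matrix ι' ι' ℝ} (hS : S.PosSemidef)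
    (hSσ : ∀ t : EuclideanSpace ℝ ι', t ⬝ᵥ S *ᵥ t
      = (∫ ω, (⟪t, G ω⟫ - ∫ z, ⟪t, G z⟫ ∂(fwdPathLaw ν₀ κF)) ^ 2 ∂(fwdPathLaw ν₀ κF))
        + 2 * ∑' k, ∫ ω, (⟪t, G ω⟫ - ∫ z, ⟪t, G z⟫ ∂(fwdPathLaw ν₀ κF))
          * (Scoring.kop ((κF ∘ₖ K).comap s h.measurable_s))^[k + 1]
              (fun ω => ⟪t, G ω⟫ - ∫ z, ⟪t, G z⟫ ∂(fwdPathLaw ν₀ κF)) ω ∂(fwdPathLaw ν₀ κF))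
    [IsProbabilityMeasure (Kernel.trajMeasure (X := fun _ : ℕ => E) μ₀
        (fun n : ℕ => ((κF ∘ₖ K).comap s h.measurable_s).comap
          (fun hh : (j : ↥(Finset.Iic n)) → E => hh ⟨n, Finset.mem_Iic.2 le_rfl⟩)
          (measurable_pi_apply _)))] :
    TendstoInDistribution (fun (n : ℕ) (ω : ℕ → E) =>
        (Real.sqrt n)⁻¹ • ∑ i ∈ Finset.range n, (G (ω i) - ∫ z, G z ∂(fwdPathLaw ν₀ κF)))
      atTop id (fun _ => Kernel.trajMeasure (X := fun _ : ℕ => E) μ₀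
        (fun n : ℕ => ((κF ∘ₖ K).comap s h.measurable_s).comap
          (fun hh : (j : ↥(Finset.Iic n)) → E => hh ⟨n, Finset.mem_Iic.2 le_rfl⟩)
          (measurable_pi_apply _))) (multivariateGaussian 0 S) := by
  refine h.tendstoInDistribution_vectorTimeAverage_restartChain_of_isGaussian K h0 hK hm0 hmin hG
    hC μ₀ (ν := multivariateGaussian 0 S) HasLaw.id (fun t => ?_) (fun t => ?_)
  · have h1 : ∫ x, ⟪t, x⟫ ∂(multivariateGaussian 0 S) = ⟪t, ∫ x, x ∂(multivariateGaussian 0 S)⟫ :=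
      integral_inner (f := fun x => x) IsGaussian.integrable_id t
    rw [h1, integral_id_multivariateGaussian, inner_zero_right]
  · rw [← covarianceBilin_self IsGaussian.memLp_two_id, covarianceBilin_multivariateGaussian hS]
    exact hSσ t

end CrooksPair

end Summit.Ventures.LatticeQCDFlow.Exactness.GeneralNCMC
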